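import Literature.AlgebraicGeometry.Resolution.KangarooAtlasCertWeighted

/-!
# Kill test K4.3 (cell `res-hironaka`, rung L, slot W4.3): kernel rows for the deciding edges

Campaign bookkeeping, OURS (seat `res-L0-k43`); NOT a statement of any manuscript and NOT a statement
about resolution of singularities.  AI review is weaker than expert review.

The kill test (pre-registered on the cell's STATUS 2026-08-26T18:33:20Z) asks whether ANY weighting of
the triple `T = (q, shade_E, rdeg)` drops at every equimultiple point of the point blow-up (M1) and of
the ATW-transplant weighted cobordant step of the kangaroo atlas (M2, conventions FW1–FW7 of
`KangarooAtlasCertWeighted`), where for a cleaned residual polynomial `F` of `x^q + F(u)` and a set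
`E` of boundary variables through the point

* `rdeg F = ord F` (the weighted atlas's second entry; over graphs `x = h(u)` this is the tree's
  `graphOrder`, cf. `Literature.Barriers.ResolutionOfSingularities.KangarooShadeIncrease`),
* `shade_E F = ord F − Σ_{i ∈ E} (least exponent of u_i in F)` (Hauser's residual order with respect
  to the boundary, the computable twin of `HauserPerlega.residualOrder` / `graphShade`),

and the boundary is propagated by `E' = {s} ∪ {u_i ∈ E : b_i = 0 ∨ i ∉ centre}` (the computable twin
of `HauserPerlega.newExceptional`).  The rows below are `decide`d computations over the sparse term
lists of `KangarooAtlasCert`; each certifies one edge of the kill-test table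
(`run/shared/lean/pub/res-hironaka/L/res-L0-k43/KILL-TEST-K4.3.md`, kit job j258413):

(K1) Hauser's `x² + y⁷ + yz⁴` over `𝔽₂`, weighted step (centre `(x²,y⁵,z⁵)`, weights `(5,2,2)`,
  `ℓ = 10`) at the `μ₂`-point `(y′,z′) = (1,0)`: `T = (2,5,5) ↦ (2,5,5)` — NO component moves
  (extends row W2 `hauser_weighted_step`, which certifies the pair `(2,5) ↦ (2,5)`).
(K2) Whitney umbrella `x² + y²z` over `𝔽₂` at the `μ₂`-point `z′ = 1`: `T = (2,3,3) ↦ (2,3,3)`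
  (extends row W1 `whitney_loop`).
(K3)–(K4) Hauser's antelope `x² + y⁵z³ + y³z⁵`, boundary `E = {y,z}`: the transplanted centre is
  `(x², y⁸, z⁸)`, weights `(4,1,1)`, `ℓ = 8`; at the étale point `(y′,z′) = (1,1)` (the kangaroo
  direction) `T = (2,2,8) ↦ (2,3,3)` — the boundary shade INCREASES `2 ↦ 3` exactly as in the
  catalogued point-blow-up barrier while `rdeg` drops `8 ↦ 3`; at `(1,0)`: `T ↦ (2,0,3)`.
(K5) the same antelope under the POINT blow-up (all weights `1`, division by `s²`) at `(1,1)`: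
  `T = (2,2,8) ↦ (2,3,9)` — the numbers of `Hauser2003_kangarooShadeIncrease`
  (`graphShade` `2 ↦ 3`, `graphOrder` `8 ↦ 9`) recomputed on the cobordant chart.
(K6)–(K7) the prior hike specimen `x² + y³z³` (`y² + x³t³` of the 2026-08-18 repair census):
  point blow-up at `(y′,z′) = (0,1)`: `T = (2,6,6) ↦ (2,3,7)` (`rdeg` `6 ↦ 7`: the census's
  «6 → 7»); weighted step (centre `(x²,y⁶,z⁶)`, weights `(3,1,1)`, `ℓ = 6`) at the same point:
  `T ↦ (2,3,3)`.
(K8) the arithmetic behind the verdict: at an edge where neither `shade_E` nor `rdeg` decreases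
  (and `q` is constant), no weighting with natural-number weights decreases.
-/

namespace Summit.ResolutionOfSingularities.ResolutionOfSingularities.Theorems.WeightedInvariant.K43KillTestRows

open Literature.AlgebraicGeometry.Resolution.KangarooAtlasCert
open Literature.AlgebraicGeometry.Resolution.KangarooAtlasCertWeighted

/-- least exponent of the variable `i` over the terms of `P` (`0` for the empty list): the
exceptional exponent `r_i` when `u_i = 0` is a boundary component through the point
(computable twin of `HauserPerlega.exceptionalExp`). (derived here) [folklore] -/
def excExp (i : ℕ) (P : Poly) : ℕ :=
  match P with
  | [] => 0
  | t :: ts => ts.foldl (fun a s => min a (s.1.getD i 0)) (t.1.getD i 0)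

/-- `|r_E| = Σ_{i ∈ E} r_i`. (derived here) [folklore] -/
def excSum (E : List ℕ) (P : Poly) : ℕ := (E.map fun i => excExp i P).sum

/-- the boundary shade `shade_E P = ord P − |r_E|` (Hauser's residual order with respect to the
boundary `E`, on a cleaned term list; computable twin of `HauserPerlega.residualOrder`).
(derived here) [folklore] -/
def shadeE (E : List ℕ) (P : Poly) : ℕ := ord P - excSum E P

/-- the kill-test triple `T = (q, shade_E, rdeg)` of a cleaned residual term list. (derived here) [folklore] -/
def tripleT (q : ℕ) (E : List ℕ) (P : Poly) : ℕ × ℕ × ℕ := (q, shadeE E P, ord P)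

/-- Hauser's `F = y⁷ + yz⁴` (variables `(y,z)`). [cite: Hauser2010, §G (the polynomial)] -/
def hauserZ1 : Poly := [([7, 0], 1), ([1, 4], 1)]

/-- Hauser's antelope residual `F² = y⁵z³ + y³z⁵ = y³z³(y² + z²)`. [cite: Hauser2010, §K] -/
def antelope : Poly := [([5, 3], 1), ([3, 5], 1)]

/-- the hike specimen `y³z³` of the prior repair census (`y² + x³t³` renamed). (derived here) [folklore] -/
def hike : Poly := [([3, 3], 1)]

/-- Whitney umbrella residual `y²z`. [cite: Temkin2025, §1.2.2] -/
def whitney : Poly := [([2, 1], 1)]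

section Rows

/-- (K1) Hauser's germ, weighted step at the `μ₂`-point `(s,x′,y′,z′) = (0,0,1,0)`: the triple is
`(2,5,5)` before (no boundary) and `(2,5,5)` after (boundary `{s}`, index `0`): a DOUBLE NON-DROP.
(derived here) [folklore] -/
theorem hauserZ1_weighted_step_tripleT :
    tripleT 2 [] hauserZ1 = (2, 5, 5) ∧
      ((wstep 2 2 [0, 1] [2, 2] 10 0 [1, 0] hauserZ1).map fun G => tripleT 2 [0] G) = some (2, 5, 5) := by
  decide +kernel

/-- (K2) Whitney umbrella, weighted step (weights `(3,2,2)`, `ℓ = 6`) at the `μ₂`-point `z′ = 1`: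
`(2,3,3) ↦ (2,3,3)`. (derived here) [folklore] -/
theorem whitney_weighted_step_tripleT :
    tripleT 2 [] whitney = (2, 3, 3) ∧
      ((wstep 2 2 [0, 1] [2, 2] 6 0 [0, 1] whitney).map fun G => tripleT 2 [0] G) = some (2, 3, 3) := by
  decide +kernel

/-- (K3) antelope: `invCoord = (2,8,8)`, centre `(x², y⁸, z⁸)`, reduced weights `(4,1,1)`, `ℓ = 8`.
(derived here) [folklore] -/
theorem antelope_invCoord :
    invCoord 2 antelope = some [2, 8, 8] ∧ centreOf 2 antelope = some ([0, 1], [8, 8]) ∧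
      isReduced 2 [8, 8] 4 [1, 1] 8 = true := by
  decide +kernel

/-- (K4) antelope with boundary `E = {y,z}`: `T = (2,2,8)`; weighted step at the étale point
`(y′,z′) = (1,1)`: `T ↦ (2,3,3)` (boundary `{s}`); at `(1,0)`: `T ↦ (2,0,3)` (boundary `{s, z′}`,
indices `0, 2`). (derived here) [folklore] -/
theorem antelope_weighted_step_tripleT :
    tripleT 2 [0, 1] antelope = (2, 2, 8) ∧
      ((wstep 2 2 [0, 1] [1, 1] 8 0 [1, 1] antelope).map fun G => tripleT 2 [0] G) = some (2, 3, 3) ∧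
      ((wstep 2 2 [0, 1] [1, 1] 8 0 [1, 0] antelope).map fun G => tripleT 2 [0, 2] G) = some (2, 0, 3) := by
  decide +kernel

/-- (K5) antelope under the POINT blow-up (cobordant presentation: all weights `1`, division by
`s^q = s²`) at `(y′,z′) = (1,1)`: `T = (2,2,8) ↦ (2,3,9)` — boundary shade `2 ↦ 3` and `rdeg`
`8 ↦ 9`, the numbers of the catalogued barrier. [cite: Hauser2003, §14 Example 2] -/
theorem antelope_point_step_tripleT :
    ((wstep 2 2 [0, 1] [1, 1] 2 0 [1, 1] antelope).map fun G => tripleT 2 [0] G) = some (2, 3, 9) := by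
  decide +kernel

/-- (K6) hike specimen, point blow-up at `(y′,z′) = (0,1)`: `T = (2,6,6) ↦ (2,3,7)`.
(derived here) [folklore] -/
theorem hike_point_step_tripleT :
    tripleT 2 [] hike = (2, 6, 6) ∧
      ((wstep 2 2 [0, 1] [1, 1] 2 0 [0, 1] hike).map fun G => tripleT 2 [0] G) = some (2, 3, 7) := by
  decide +kernel

/-- (K7) hike specimen, weighted step: `invCoord = (2,6,6)`, weights `(3,1,1)`, `ℓ = 6`; at
`(y′,z′) = (0,1)`: `T ↦ (2,3,3)`. (derived here) [folklore] -/
theorem hike_weighted_step_tripleT :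
    invCoord 2 hike = some [2, 6, 6] ∧ isReduced 2 [6, 6] 3 [1, 1] 6 = true ∧
      ((wstep 2 2 [0, 1] [1, 1] 6 0 [0, 1] hike).map fun G => tripleT 2 [0] G) = some (2, 3, 3) := by
  decide +kernel

end Rows

/-- (K8) At an edge where the order `q` is unchanged and neither the boundary shade nor `rdeg`
decreases, no weighting `w₁·q + w₂·shade + w₃·rdeg` with natural-number weights decreases.
(derived here) [folklore] -/
theorem no_weighting_drops_at_double_nondrop (w₁ w₂ w₃ q s r s' r' : ℕ) (hs : s ≤ s') (hr : r ≤ r') :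
    ¬ (w₁ * q + w₂ * s' + w₃ * r' < w₁ * q + w₂ * s + w₃ * r) := by
  have h₂ := Nat.mul_le_mul_left w₂ hs
  have h₃ := Nat.mul_le_mul_left w₃ hr
  omega

end Summit.ResolutionOfSingularities.ResolutionOfSingularities.Theorems.WeightedInvariant.K43KillTestRows
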